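import Summits.Schanuel.Schanuel.Theorems.DiophantineDichotomyApproximationPropertySpaceCIMacaulay
import HarnessLib

/-!
# A Hilbert-function lower bound for a prime space curve lying on a complete intersection (siege k23)

Crux `stmt-Schanuel-6117`
(`Summit.Schanuel.Schanuel.Theses.DiophantineDichotomy.ApproximationProperty`), line
`orbit-interpolation-determinant`, stub `CycleAPIAt3 : CycleAPIAt 3` (Philippon's 0-cycle
approximation property in `ℙ³` with the interpolation clause). Everything here is PROVED; no
definitions, no named facts. `--supports` helper: the monomial count of the THIRD hypersurface
section of the `t = 3` descent ("Chardin Hilbert-function bound" variation), built on the landed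
Macaulay / prime-avoidance toolkit `…SpaceCIMacaulay.lean` (`SpaceCI.*`).

## What is proved

Let `S = ℚ[x₀, x₁, x₂, x₃]` (`Rx 3`), `Q ≠ 0` a form of degree `a ≥ 1` generating a prime ideal,
`R ∉ (Q)` a form of degree `b ≥ 1` (so `V(Q) ∩ V(R)` is a complete-intersection curve of type
`(a, b)`), and `𝔭 ⊇ (Q, R)` ANY homogeneous prime — in the application: a prime component of that
curve, the small curve `𝔭₂` selected by the weighted pigeonhole at stage 2 of the descent. Write
`H(I; n) = dim S_n − dim I_n` and suppose the first difference of `H(𝔭; ·)` is eventually the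
constant `e` (for a prime of Krull dimension `2` this `e ≥ 1` is the degree of the curve `V(𝔭)`,
the leading coefficient of its Hilbert polynomial). Then

  **`H(𝔭; ν) ≥ (ν − a − b) · e` for every `ν ≥ a + b`**

(`CurveOnCIHilbert.hilbert_lower_bound`, stated subtraction-free as
`dim 𝔭_ν + (ν − (a + b)) e ≤ dim S_ν`). With the third cut taken in degree `b₃ = ⌊κ c Δ⌋ ≥ 2(a + b)`
this gives `H(𝔭₂; b₃) ≥ e b₃ / 2` free monomials for Dirichlet's box principle modulo `𝔭₂`
(`…RelativeBox.lean`), which is what the stage-3 numerology needs (`≥ 8 Δ deg 𝔭₂ / c`), in EVERY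
case — in particular in the case left open in the lead's notes (`𝔭₂` lying on a surface of low
degree `g₀ < g*` besides `Q₁`), where the generic-projection bound `C(ν+2, 2) − C(ν+2−deg 𝔭, 2)`
(Nesterenko 1984 / Chardin 1989) and the truncation bound `H(𝔭₂; ν) ≥ H((Q₁); min(ν, g₀ − 1))` are
both too weak. (What it does NOT give: the comparison `e ≥ ideg 𝔭 2` of the Hilbert degree with
Nesterenko's Chow-form degree, which the assembly also needs; the threshold conversion here is
independent of how that comparison is obtained.)

## Proof (elementary liaison-type comparison with the complete intersection)

* From `SpaceCI`: every associated prime of `S/(Q, R)` has `dim = 2`, so there is a linear form `ℓ`,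
  `ℓ ∉ 𝔭`, which is a non-zero-divisor modulo `(Q, R)` (if `𝔭` misses a variable; a prime containing
  all variables is the trivial case `e = 0`); every associated prime of `K₁ = (Q, R, ℓ)` has `dim = 1`,
  so there is a second linear form `L`, a non-zero-divisor modulo `K₁`.
* `idealDegree_K₁` — three hypersurface-section formulas (`finrank_idealDegree_sup_span_add_eq` for
  `(0, Q)`, `((Q), R)`, `((Q, R), ℓ)`) and `dim S_n = C(n+3, 3)` give `H(K₁; n) = ab` for
  `n ≥ a + b + 1` (`choose_ci_identity` is the closed-form binomial arithmetic).
* `mono_step`, `mono` — for ideals `K₁ ≤ K₂` and a linear non-zero-divisor `L` modulo `K₁`,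
  `n ↦ dim (K₂)_n − dim (K₁)_n` is non-decreasing (multiplication by `L` embeds `(K₂/K₁)_n` into
  `(K₂/K₁)_{n+1}`; written with the modular law on finite-dimensional subspaces). NOTE: no
  non-zero-divisor modulo `K₂` is needed — `K₂ = 𝔭 + (ℓ)` may have an embedded component at the
  irrelevant ideal when the curve `V(𝔭)` is not arithmetically Cohen–Macaulay.
* `hilbert_lower_bound` — with `K₂ = 𝔭 + (ℓ)`: `H(K₂; n+1) = H(𝔭; n+1) − H(𝔭; n) = e` eventually,
  so the non-decreasing `dim (K₂)_n − dim (K₁)_n` tends to `ab − e` and is `≤ ab − e` throughout;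
  hence `H(K₂; n) ≥ H(K₁; n) − (ab − e) = e` for `n ≥ a + b + 1`, i.e. `H(𝔭; n) − H(𝔭; n−1) ≥ e`
  there; summing from `a + b` gives the bound.

Sources: the Hilbert function of a complete intersection (Nesterenko–Philippon (eds.), LNM 1752,
Ch. 11 §2.2; Philippon, Bull. SMF 114 (1986) Lemme 3.1); the comparison is the degree-by-degree
form of `deg C ≤ deg X` for a component `C` of a complete intersection `X` (liaison count, only the
inequality, no duality needed).
-/

set_option linter.dupNamespace false

noncomputable section

attribute [local instance] MvPolynomial.gradedAlgebra

namespace Summit.Schanuel.Schanuel.Cruxes.ApproximationProperty.OrbitInterpolationDeterminant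

open Literature.NumberTheory.Transcendental.Nesterenko MvPolynomial Module
open Literature.RingTheory.MvPolynomial

namespace CurveOnCIHilbert

/-! ## Binomial arithmetic: the Hilbert function of a complete intersection of type `(a, b, 1)` -/

/-- `2 C(n+2, 2) = (n+1)(n+2)`. [folklore] -/
theorem two_mul_choose_two (n : ℕ) : 2 * (n + 2).choose 2 = (n + 1) * (n + 2) := by
  induction n with
  | zero => decide
  | succ n ih =>
    have h : (n + 1 + 2).choose 2 = (n + 2).choose 1 + (n + 2).choose 2 :=
      Nat.choose_succ_succ (n + 2) 1
    rw [h, Nat.choose_one_right, mul_add, ih]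
    ring

/-- `6 C(n+3, 3) = (n+1)(n+2)(n+3)`. [folklore] -/
theorem six_mul_choose_three (n : ℕ) : 6 * (n + 3).choose 3 = (n + 1) * (n + 2) * (n + 3) := by
  induction n with
  | zero => decide
  | succ n ih =>
    have h : (n + 1 + 3).choose 3 = (n + 3).choose 2 + (n + 3).choose 3 :=
      Nat.choose_succ_succ (n + 3) 2
    have h2 := two_mul_choose_two (n + 1)
    rw [show n + 1 + 2 = n + 3 by ring] at h2
    rw [h, mul_add, ih]
    nlinarith [h2]

/-- The second mixed difference of `n ↦ C(n+3, 3)` with steps `a`, `b` (after one more unit step)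
is `ab`: the Hilbert function of `S/(Q, R, ℓ)`, `S = ℚ[x₀, …, x₃]`, for a regular sequence of
degrees `(a, b, 1)` is `ab` from degree `a + b + 1` on (in the subtraction-free arrangement used by
`idealDegree_K₁`). [folklore] -/
theorem choose_ci_identity (w a b : ℕ) :
    (w + a + b + 1 + 3).choose 3 + (w + b + 3).choose 3 + (w + a + 3).choose 3 +
        (w + 1 + 3).choose 3 =
      (w + a + b + 3).choose 3 + (w + b + 1 + 3).choose 3 + (w + a + 1 + 3).choose 3 +
        (w + 3).choose 3 + a * b := by
  apply Nat.eq_of_mul_eq_mul_left (show 0 < 6 by norm_num)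
  have h1 := six_mul_choose_three (w + a + b + 1)
  have h2 := six_mul_choose_three (w + b)
  have h3 := six_mul_choose_three (w + a)
  have h4 := six_mul_choose_three (w + 1)
  have h5 := six_mul_choose_three (w + a + b)
  have h6 := six_mul_choose_three (w + b + 1)
  have h7 := six_mul_choose_three (w + a + 1)
  have h8 := six_mul_choose_three w
  simp only [mul_add]
  rw [h1, h2, h3, h4, h5, h6, h7, h8]
  ring

/-- `dim S_n = C(n+3, 3)` for `S = ℚ[x₀, x₁, x₂, x₃]`. [folklore] -/
theorem finrank_homogeneousSubmodule_four (n : ℕ) :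
    finrank ℚ (homogeneousSubmodule (Fin (3 + 1)) ℚ n) = (n + 3).choose 3 := by
  rw [Literature.RingTheory.HilbertSamuel.finrank_homogeneousSubmodule_fin,
    show n + (3 + 1) - 1 = n + 3 by omega]
  exact Nat.choose_symm_add

/-! ## The Hilbert function of `K₁ = (Q, R, ℓ)` -/

/-- **`H(K₁; n) = ab` for `n ≥ a + b + 1`**, `K₁ = (Q, R, ℓ)`, in the subtraction-free form
`dim (K₁)_n + ab = dim S_n`: three hypersurface sections by the regular sequence `Q, R, ℓ`.
[cite: Philippon1986, Lemme 3.1] -/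
theorem idealDegree_K₁ {Q R ℓ : Rx 3} {a b : ℕ} (hQ0 : Q ≠ 0)
    (hQ : Q.IsHomogeneous a) (hR : R.IsHomogeneous b)
    (hprime : (Ideal.span {Q}).IsPrime) (hRQ : R ∉ Ideal.span {Q}) (hℓ1 : ℓ.IsHomogeneous 1)
    (hℓ0 : ℓ ≠ 0)
    (hnzd : ∀ f, ℓ * f ∈ Ideal.span {Q} ⊔ Ideal.span {R} → f ∈ Ideal.span {Q} ⊔ Ideal.span {R})
    {n : ℕ} (hn : a + b + 1 ≤ n) :
    finrank ℚ (idealDegree (Ideal.span {Q} ⊔ Ideal.span {R} ⊔ Ideal.span {ℓ}) n) + a * b =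
      finrank ℚ (homogeneousSubmodule (Fin (3 + 1)) ℚ n) := by
  letI : GradedAlgebra (homogeneousSubmodule (Fin (3 + 1)) ℚ) := MvPolynomial.gradedAlgebra
  have hQhom := SpaceCI.isHomogeneous_span hQ
  have hJhom :
      (Ideal.span {Q} ⊔ Ideal.span {R}).IsHomogeneous (homogeneousSubmodule (Fin (3 + 1)) ℚ) :=
    hQhom.sup (SpaceCI.isHomogeneous_span hR)
  have hR0 : R ≠ 0 := by
    rintro rfl
    exact hRQ (Ideal.zero_mem _)
  have hnzdQ : ∀ f, Q * f ∈ (⊥ : Ideal (Rx 3)) → f ∈ (⊥ : Ideal (Rx 3)) := fun f hf => by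
    rw [Ideal.mem_bot] at hf ⊢
    exact (mul_eq_zero.mp hf).resolve_left hQ0
  have hnzdR : ∀ f, R * f ∈ Ideal.span {Q} → f ∈ Ideal.span {Q} := fun f hf =>
    (hprime.mem_or_mem hf).resolve_left hRQ
  -- the three section formulas, as functions of the degree
  set d : ℕ → ℕ := fun n => finrank ℚ (homogeneousSubmodule (Fin (3 + 1)) ℚ n) with hd
  set q : ℕ → ℕ := fun n => finrank ℚ (idealDegree (Ideal.span {Q}) n) with hq
  set j : ℕ → ℕ := fun n => finrank ℚ (idealDegree (Ideal.span {Q} ⊔ Ideal.span {R}) n) with hj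
  set k : ℕ → ℕ := fun n =>
    finrank ℚ (idealDegree (Ideal.span {Q} ⊔ Ideal.span {R} ⊔ Ideal.span {ℓ}) n) with hk
  have Hq : ∀ t, q (t + a) = d t := by
    intro t
    have h := finrank_idealDegree_sup_span_add_eq (Ideal.IsHomogeneous.bot _) hQ0 hQ hnzdQ t
    rw [bot_sup_eq, idealDegree_bot, idealDegree_bot, finrank_bot] at h
    simpa using h
  have Hj : ∀ t, j (t + b) + q t = q (t + b) + d t := fun t =>
    finrank_idealDegree_sup_span_add_eq hQhom hR0 hR hnzdR t
  have Hk : ∀ t, k (t + 1) + j t = j (t + 1) + d t := fun t =>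
    finrank_idealDegree_sup_span_add_eq hJhom hℓ0 hℓ1 hnzd t
  have Hd : ∀ n, d n = (n + 3).choose 3 := fun n => finrank_homogeneousSubmodule_four n
  -- bookkeeping at `n = w + a + b + 1`
  obtain ⟨w, rfl⟩ : ∃ w, n = w + a + b + 1 := ⟨n - a - b - 1, by omega⟩
  show k (w + a + b + 1) + a * b = d (w + a + b + 1)
  have e1 : k (w + a + b + 1) + j (w + a + b) = j (w + a + b + 1) + d (w + a + b) := Hk (w + a + b)
  have e2 : j (w + a + b + 1) + q (w + a + 1) = q (w + a + b + 1) + d (w + a + 1) := by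
    have h := Hj (w + a + 1); rwa [show w + a + 1 + b = w + a + b + 1 by ring] at h
  have e3 : j (w + a + b) + q (w + a) = q (w + a + b) + d (w + a) := Hj (w + a)
  have e4 : q (w + a + b + 1) = d (w + b + 1) := by
    have h := Hq (w + b + 1); rwa [show w + b + 1 + a = w + a + b + 1 by ring] at h
  have e5 : q (w + a + b) = d (w + b) := by
    have h := Hq (w + b); rwa [show w + b + a = w + a + b by ring] at h
  have e6 : q (w + a + 1) = d (w + 1) := by
    have h := Hq (w + 1); rwa [show w + 1 + a = w + a + 1 by ring] at h
  have e7 : q (w + a) = d w := Hq w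
  have hid := choose_ci_identity w a b
  rw [← Hd, ← Hd, ← Hd, ← Hd, ← Hd, ← Hd, ← Hd, ← Hd] at hid
  omega

/-! ## Monotonicity of `n ↦ dim (K₂)_n − dim (K₁)_n` for a linear non-zero-divisor modulo `K₁` -/

/-- **One step of monotonicity.** For ideals `K₁ ≤ K₂` and a linear form `L ≠ 0` which is a
non-zero-divisor modulo `K₁`: `dim (K₂)_n + dim (K₁)_{n+1} ≤ dim (K₂)_{n+1} + dim (K₁)_n`
(multiplication by `L` embeds `(K₂)_n / (K₁)_n` into `(K₂)_{n+1} / (K₁)_{n+1}`; here through the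
modular law for `L · (K₂)_n` and `(K₁)_{n+1}`). [folklore] -/
theorem mono_step {K₁ K₂ : Ideal (Rx 3)} (hle : K₁ ≤ K₂) {L : Rx 3} (hL1 : L.IsHomogeneous 1)
    (hL0 : L ≠ 0) (hnzd : ∀ f, L * f ∈ K₁ → f ∈ K₁) (n : ℕ) :
    finrank ℚ (idealDegree K₂ n) + finrank ℚ (idealDegree K₁ (n + 1)) ≤
      finrank ℚ (idealDegree K₂ (n + 1)) + finrank ℚ (idealDegree K₁ n) := by
  set U := idealDegree K₂ n
  set V := idealDegree K₁ n
  set U' := idealDegree K₂ (n + 1)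
  set V' := idealDegree K₁ (n + 1)
  set LU := U.map (LinearMap.mulLeft ℚ L)
  -- `L · (K₂)_n ≤ (K₂)_{n+1}`
  have hLU : LU ≤ U' := by
    rintro _ ⟨u, ⟨huK, hun⟩, rfl⟩
    refine ⟨K₂.mul_mem_left L huK, ?_⟩
    simpa [add_comm] using hL1.mul (show u.IsHomogeneous n from hun)
  -- `L · (K₂)_n ∩ (K₁)_{n+1} ≤ L · (K₁)_n` (the non-zero-divisor property)
  have hinf : LU ⊓ V' ≤ V.map (LinearMap.mulLeft ℚ L) := by
    rintro _ ⟨⟨u, ⟨-, hun⟩, rfl⟩, hK₁, -⟩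
    exact ⟨u, ⟨hnzd u hK₁, hun⟩, rfl⟩
  have hV'U' : V' ≤ U' := idealDegree_mono hle (n + 1)
  have hmod := Submodule.finrank_sup_add_finrank_inf_eq LU V'
  have h1 : finrank ℚ ↥(LU ⊔ V') ≤ finrank ℚ U' := Submodule.finrank_mono (sup_le hLU hV'U')
  have h2 : finrank ℚ ↥(LU ⊓ V') ≤ finrank ℚ V := by
    calc finrank ℚ ↥(LU ⊓ V') ≤ finrank ℚ (V.map (LinearMap.mulLeft ℚ L)) :=
          Submodule.finrank_mono hinf
      _ = finrank ℚ V := finrank_map_mulLeft hL0 V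
  have h3 : finrank ℚ LU = finrank ℚ U := finrank_map_mulLeft hL0 U
  calc finrank ℚ U + finrank ℚ V' = finrank ℚ LU + finrank ℚ V' := by rw [h3]
    _ = finrank ℚ ↥(LU ⊔ V') + finrank ℚ ↥(LU ⊓ V') := hmod.symm
    _ ≤ finrank ℚ U' + finrank ℚ V := add_le_add h1 h2

/-- **Monotonicity, iterated**: `dim (K₂)_n − dim (K₁)_n ≤ dim (K₂)_N − dim (K₁)_N` for `n ≤ N`
(subtraction-free). [folklore] -/
theorem mono {K₁ K₂ : Ideal (Rx 3)} (hle : K₁ ≤ K₂) {L : Rx 3} (hL1 : L.IsHomogeneous 1)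
    (hL0 : L ≠ 0) (hnzd : ∀ f, L * f ∈ K₁ → f ∈ K₁) {n N : ℕ} (hnN : n ≤ N) :
    finrank ℚ (idealDegree K₂ n) + finrank ℚ (idealDegree K₁ N) ≤
      finrank ℚ (idealDegree K₂ N) + finrank ℚ (idealDegree K₁ n) := by
  obtain ⟨w, rfl⟩ := Nat.exists_eq_add_of_le hnN
  induction w with
  | zero => simp
  | succ w ih =>
    have h := mono_step hle hL1 hL0 hnzd (n + w)
    rw [show n + (w + 1) = n + w + 1 by ring]
    have := ih (Nat.le_add_right n w)
    omega

/-! ## The lower bound -/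

/-- In the degenerate case of a prime containing all the variables, the forms of every positive
degree all lie in it. [folklore] -/
theorem finrank_idealDegree_eq_of_forall_X_mem {𝔭 : Ideal (Rx 3)}
    (hX : ∀ i, (X i : Rx 3) ∈ 𝔭) {n : ℕ} (hn : 1 ≤ n) :
    finrank ℚ (idealDegree 𝔭 n) = finrank ℚ (homogeneousSubmodule (Fin (3 + 1)) ℚ n) := by
  have heq : idealDegree 𝔭 n = homogeneousSubmodule (Fin (3 + 1)) ℚ n :=
    le_antisymm (idealDegree_le_homogeneousSubmodule 𝔭 n) fun f hf =>
      ⟨ker_constantCoeff_le_of_forall_X_mem hX (SpaceCI.mem_ker_constantCoeff_of_isHomogeneous hf hn), hf⟩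
  rw [heq]

/-- **The Hilbert-function lower bound for a prime containing a space complete intersection.**
Let `Q ≠ 0` be a form of degree `a ≥ 1` of `S = ℚ[x₀, …, x₃]` generating a prime ideal,
`R ∉ (Q)` a form of degree `b ≥ 1`, and `𝔭 ∋ Q, R` a homogeneous prime whose Hilbert function
`H(𝔭; n) = dim S_n − dim 𝔭_n` has eventually constant first difference `e`
(`H(𝔭; ν+1) = H(𝔭; ν) + e` for `ν ≥ ν₀`). Then `H(𝔭; ν) ≥ (ν − a − b) · e` for all `ν ≥ a + b`,
i.e. `dim 𝔭_ν + (ν − (a + b)) e ≤ dim S_ν`. (For a prime of Krull dimension `2`, `e` is the degree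
of the curve `V(𝔭)`; the bound says that the curve imposes at least `e` new conditions on forms in
each degree beyond `a + b`.) [folklore] -/
theorem hilbert_lower_bound {Q R : Rx 3} {a b : ℕ} (hQ0 : Q ≠ 0)
    (hQ : Q.IsHomogeneous a) (hR : R.IsHomogeneous b) (ha : 1 ≤ a) (hb : 1 ≤ b)
    (hprime : (Ideal.span {Q}).IsPrime) (hRQ : R ∉ Ideal.span {Q})
    {𝔭 : Ideal (Rx 3)} (h𝔭 : 𝔭.IsPrime)
    (h𝔭hom : 𝔭.IsHomogeneous (homogeneousSubmodule (Fin (3 + 1)) ℚ))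
    (hQ𝔭 : Q ∈ 𝔭) (hR𝔭 : R ∈ 𝔭) {e ν₀ : ℕ}
    (he : ∀ ν, ν₀ ≤ ν →
      finrank ℚ (homogeneousSubmodule (Fin (3 + 1)) ℚ (ν + 1)) + finrank ℚ (idealDegree 𝔭 ν) =
        finrank ℚ (homogeneousSubmodule (Fin (3 + 1)) ℚ ν) + finrank ℚ (idealDegree 𝔭 (ν + 1)) + e)
    {ν : ℕ} (hν : a + b ≤ ν) :
    finrank ℚ (idealDegree 𝔭 ν) + (ν - (a + b)) * e ≤
      finrank ℚ (homogeneousSubmodule (Fin (3 + 1)) ℚ ν) := by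
  letI : GradedAlgebra (homogeneousSubmodule (Fin (3 + 1)) ℚ) := MvPolynomial.gradedAlgebra
  set d : ℕ → ℕ := fun n => finrank ℚ (homogeneousSubmodule (Fin (3 + 1)) ℚ n) with hd
  set p : ℕ → ℕ := fun n => finrank ℚ (idealDegree 𝔭 n) with hp
  change ∀ ν, ν₀ ≤ ν → d (ν + 1) + p ν = d ν + p (ν + 1) + e at he
  change p ν + (ν - (a + b)) * e ≤ d ν
  have hpd : ∀ n, p n ≤ d n := fun n => finrank_idealDegree_le 𝔭 n
  -- the degenerate case: `𝔭` contains all the variables, and then `e = 0`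
  by_cases hX : ∃ i, (X i : Rx 3) ∉ 𝔭
  swap
  · push Not at hX
    have h1 : p (ν₀ + 1) = d (ν₀ + 1) := finrank_idealDegree_eq_of_forall_X_mem hX (by omega)
    have h2 : p (ν₀ + 1 + 1) = d (ν₀ + 1 + 1) :=
      finrank_idealDegree_eq_of_forall_X_mem hX (by omega)
    have h3 := he (ν₀ + 1) (by omega)
    have he0 : e = 0 := by omega
    rw [he0, mul_zero, add_zero]
    exact hpd ν
  -- the two linear forms and the two auxiliary ideals
  have hAss2 : ∀ 𝔯 ∈ associatedPrimes (Rx 3) (Rx 3 ⧸ (Ideal.span {Q} ⊔ Ideal.span {R})),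
      ringKrullDim (Rx 3 ⧸ 𝔯) ≠ 0 := fun 𝔯 h𝔯 => by
    rw [SpaceCI.ringKrullDim_quotient_eq_two hQ0 hQ hR ha hb hprime hRQ h𝔯]; norm_num
  obtain ⟨ℓ, hℓ1, hℓ0, hℓP, hℓnzd⟩ := SpaceCI.exists_linear_nzd hAss2 {𝔭} (by simpa using hX)
  have hℓ𝔭 : ℓ ∉ 𝔭 := hℓP 𝔭 (Finset.mem_singleton_self 𝔭)
  have hAss1 : ∀ 𝔯 ∈ associatedPrimes (Rx 3)
      (Rx 3 ⧸ (Ideal.span {Q} ⊔ Ideal.span {R} ⊔ Ideal.span {ℓ})), ringKrullDim (Rx 3 ⧸ 𝔯) ≠ 0 :=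
    fun 𝔯 h𝔯 => by
      rw [SpaceCI.ringKrullDim_quotient_eq_one hQ0 hQ hR hℓ1 ha hb le_rfl hprime hRQ hℓnzd h𝔯]
      norm_num
  obtain ⟨L, hL1, hL0, -, hLnzd⟩ := SpaceCI.exists_linear_nzd hAss1 ∅ (by simp)
  set K₁ : Ideal (Rx 3) := Ideal.span {Q} ⊔ Ideal.span {R} ⊔ Ideal.span {ℓ} with hK₁
  set K₂ : Ideal (Rx 3) := 𝔭 ⊔ Ideal.span {ℓ} with hK₂
  have hle : K₁ ≤ K₂ :=
    sup_le (sup_le ((Ideal.span_singleton_le_iff_mem _).mpr hQ𝔭)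
      ((Ideal.span_singleton_le_iff_mem _).mpr hR𝔭) |>.trans le_sup_left) le_sup_right
  set k₁ : ℕ → ℕ := fun n => finrank ℚ (idealDegree K₁ n) with hk₁
  set k₂ : ℕ → ℕ := fun n => finrank ℚ (idealDegree K₂ n) with hk₂
  -- the section `(𝔭, ℓ)`
  have hnzd𝔭 : ∀ f, ℓ * f ∈ 𝔭 → f ∈ 𝔭 := fun f hf => (h𝔭.mem_or_mem hf).resolve_left hℓ𝔭
  have Hk₂ : ∀ t, k₂ (t + 1) + p t = p (t + 1) + d t := fun t =>
    finrank_idealDegree_sup_span_add_eq h𝔭hom hℓ0 hℓ1 hnzd𝔭 t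
  -- the Hilbert function of `K₁`
  have Hk₁ : ∀ n, a + b + 1 ≤ n → k₁ n + a * b = d n := fun n hn =>
    idealDegree_K₁ hQ0 hQ hR hprime hRQ hℓ1 hℓ0 hℓnzd hn
  -- monotonicity
  have Hmono : ∀ n N, n ≤ N → k₂ n + k₁ N ≤ k₂ N + k₁ n := fun n N hnN =>
    mono hle hL1 hL0 hLnzd hnN
  -- `H(K₂; n) ≥ e` for `n ≥ a + b + 1`
  have Hstep : ∀ n, a + b + 1 ≤ n → k₂ n + e ≤ d n := by
    intro n hn
    obtain ⟨M, hM1, hM2⟩ : ∃ M, n ≤ M + 1 ∧ ν₀ ≤ M := ⟨max n ν₀, by omega, le_max_right _ _⟩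
    have h1 := Hmono n (M + 1) hM1
    have h2 := Hk₁ (M + 1) (by omega)
    have h3 := Hk₁ n hn
    have h4 := Hk₂ M
    have h5 := he M hM2
    omega
  -- `H(𝔭; n + 1) ≥ H(𝔭; n) + e` for `n ≥ a + b`, and induction
  have Hdiff : ∀ n, a + b ≤ n → p (n + 1) + d n + e ≤ d (n + 1) + p n := by
    intro n hn
    have h1 := Hk₂ n
    have h2 := Hstep (n + 1) (by omega)
    omega
  obtain ⟨w, rfl⟩ := Nat.exists_eq_add_of_le hν
  rw [Nat.add_sub_cancel_left]
  induction w with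
  | zero => simpa using hpd (a + b)
  | succ w ih =>
    have h1 := Hdiff (a + b + w) (Nat.le_add_right _ _)
    have h2 := ih (Nat.le_add_right _ _)
    rw [show a + b + (w + 1) = a + b + w + 1 by ring, Nat.succ_mul]
    omega

end CurveOnCIHilbert

/-- **Registered sub-goal `curveOnCI_hilbertLowerBound`** (helper for stub `CycleAPIAt3`): the
Hilbert-function lower bound `dim 𝔭_ν + (ν − (a + b)) e ≤ dim S_ν` (`ν ≥ a + b`) for any homogeneous
prime `𝔭 ⊇ (Q, R)` of `S = ℚ[x₀, …, x₃]`, `(Q, R)` a complete intersection of type `(a, b)`, whose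
Hilbert function has eventual first difference `e` (= `CurveOnCIHilbert.hilbert_lower_bound`).
[folklore] -/
theorem curveOnCI_hilbertLowerBound : ∀ (Q R : Rx 3) (a b : ℕ), Q ≠ 0 → Q.IsHomogeneous a → R.IsHomogeneous b → 1 ≤ a → 1 ≤ b → (Ideal.span {Q}).IsPrime → R ∉ Ideal.span {Q} → ∀ 𝔭 : Ideal (Rx 3), 𝔭.IsPrime → (letI := MvPolynomial.gradedAlgebra (σ := Fin (3 + 1)) (R := ℚ); 𝔭.IsHomogeneous (homogeneousSubmodule (Fin (3 + 1)) ℚ)) → Q ∈ 𝔭 → R ∈ 𝔭 → ∀ e ν₀ : ℕ, (∀ ν : ℕ, ν₀ ≤ ν → Module.finrank ℚ ↥(MvPolynomial.homogeneousSubmodule (Fin (3 + 1)) ℚ (ν + 1)) + Module.finrank ℚ ↥(Literature.RingTheory.MvPolynomial.idealDegree 𝔭 ν) = Module.finrank ℚ ↥(MvPolynomial.homogeneousSubmodule (Fin (3 + 1)) ℚ ν) + Module.finrank ℚ ↥(Literature.RingTheory.MvPolynomial.idealDegree 𝔭 (ν + 1)) + e) → ∀ ν : ℕ, a + b ≤ ν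 → Module.finrank ℚ ↥(Literature.RingTheory.MvPolynomial.idealDegree 𝔭 ν) + (ν - (a + b)) * e ≤ Module.finrank ℚ ↥(MvPolynomial.homogeneousSubmodule (Fin (3 + 1)) ℚ ν) := by
  intro Q R a b hQ0 hQ hR ha hb hprime hRQ 𝔭 h𝔭 h𝔭hom hQ𝔭 hR𝔭 e ν₀ he ν hν
  exact CurveOnCIHilbert.hilbert_lower_bound hQ0 hQ hR ha hb hprime hRQ h𝔭 h𝔭hom hQ𝔭 hR𝔭 he hν

end Summit.Schanuel.Schanuel.Cruxes.ApproximationProperty.OrbitInterpolationDeterminant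

end
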